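import Summits.Ventures.CertifiedManyBodySolver.Upper.UMPSDualBoundBridge
import Literature.MathematicalPhysics.QuantumLattice.HubbardJordanWigner
import Literature.MathematicalPhysics.QuantumLattice.HubbardChainGrandCanonicalUpperBound
import HarnessLib

/-!
# uMPS upper bound for the Hubbard chain, I: the bond operator `g` and the bookkeeping (c)

HONEST FRAMING: first certified bounds; not a superconductivity verdict; every number certified or
labelled float.

Venture `Ventures/CertifiedManyBodySolver` (sr-mbsolver), VAR's `METHOD-umps.md` Theorem U1, step (c)
("bookkeeping") on the TENSOR side, in the tree's site-major Jordan–Wigner convention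
(`JordanWigner.toSpin`, physical index `k : Fin 4`, `0 = ∅, 1 = ↑, 2 = ↓, 3 = ↑↓` — VAR's
`s = 2 n↑ + n↓` is `k` with `1 ↔ 2` swapped; certificate generators permute the physical index):

* `hopMatrix t` — the two-site hopping word `-t Σ_σ ((c†_σ F) ⊗ c_σ + (F c_σ) ⊗ c†_σ)` (16 × 16);
* `bondMatrix t U = hopMatrix t + U (n↑n↓ ⊗ 1) + (U/2) ((1 − n) ⊗ 1)` — METHOD-umps §1's bond
  operator `g` (on-site terms on the LEFT site, particle–hole symmetrised);
* `toSpin_hamiltonian_pathGraph_eq_bondSum` — on `n + 2` sites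
  `toSpin H_{path} = bondSum n (hopMatrix t) + U Σ_i onSite i n↑n↓` (from lit-1's
  `JordanWigner.toSpin_hamiltonian_pathGraph`);
* `mixture A r n O = Σ_l ⟨ψ_l, O ψ_l⟩` — the expectation functional of the boundary-propagated MPS
  mixture (`ψ_l = mpsOpen (n+2) A e_l r`), its linearity and positivity;
* `bookkeeping_le` — **(c)**: for `U ≥ 0`, a left-isometric `A` and a unit `r`,
  `2 Re mixture(toSpin H) + U ((n+2) − Re mixture(toSpin N̂)) ≤ 2 Re mixture(bondSum n g) + 3U`.

Part II (`Upper/UMPSEnergyBound.lean`) moves the mixture to Fock space and combines with the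
telescoping bound (`UMPSDualBound`), the sector pairing (d)
(`groundEnergyAt_pathGraph_double_le_re_trace`) and the limit (e).
-/

noncomputable section

open Matrix Finset
open scoped ComplexOrder BigOperators Kronecker

namespace Summit.Ventures.CertifiedManyBodySolver.Upper

open Literature.MathematicalPhysics.QuantumLattice
open Literature.MathematicalPhysics.QuantumLattice.JordanWigner

/-! ### The bond operator -/

/-- The two-site hopping word of the open Hubbard chain in the site-major Jordan–Wigner basis:
`-t Σ_σ ((c†_σ F) ⊗ c_σ + (F c_σ) ⊗ c†_σ)` (rows/columns `Fin 4 × Fin 4` = (left, right)). -/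
def hopMatrix (t : ℝ) : Matrix (Fin 4 × Fin 4) (Fin 4 × Fin 4) ℂ :=
  -(t : ℂ) • ∑ σ : Fin 2, ((siteCreation σ * siteParity) ⊗ₖ siteAnnihilation σ +
    (siteParity * siteAnnihilation σ) ⊗ₖ siteCreation σ)

/-- METHOD-umps §1's bond operator `g = hop + U (n↑n↓)₁ + (U/2)(1 − n₁)` (on-site terms attached to
the LEFT site of the bond; the `(U/2)(1 − n)` term makes the functional particle–hole symmetric). -/
def bondMatrix (t U : ℝ) : Matrix (Fin 4 × Fin 4) (Fin 4 × Fin 4) ℂ :=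
  hopMatrix t + (U : ℂ) • (siteDouble ⊗ₖ (1 : Matrix (Fin 4) (Fin 4) ℂ)) +
    ((U / 2 : ℝ) : ℂ) • ((1 - siteTotalNumber) ⊗ₖ (1 : Matrix (Fin 4) (Fin 4) ℂ))

/-- **The open chain in bond form**: on `n + 2` sites,
`toSpin H_{path(n+2)}(t, U) = bondSum n (hopMatrix t) + U Σ_i onSite i (n↑n↓)`. -/
theorem toSpin_hamiltonian_pathGraph_eq_bondSum (n : ℕ) (t U : ℝ) :
    toSpin (hamiltonian (SimpleGraph.pathGraph (n + 2)) t U) =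
      bondSum n (hopMatrix t) + (U : ℂ) • ∑ i : Fin (n + 2), onSite i siteDouble := by
  rw [toSpin_hamiltonian_pathGraph, sum_sum_ite_val_succ_eq]
  congr 1
  rw [hopMatrix, bondSum_smul, bondSum_sum]
  congr 1
  rw [Finset.sum_comm]
  refine Finset.sum_congr rfl fun σ _ => ?_
  rw [bondSum_add, bondSum_kronecker, bondSum_kronecker, ← Finset.sum_add_distrib]

/-- **The bond sum of `g`**: `bondSum n g = bondSum n hop + U Σ_{x ≤ n} (n↑n↓)_x + (U/2) Σ_{x ≤ n} (1 − n)_x`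
(sums over the LEFT sites of the `n + 1` bonds, i.e. all sites but the last). -/
theorem bondSum_bondMatrix (n : ℕ) (t U : ℝ) :
    (bondSum n (bondMatrix t U) : Op (Fin (n + 2)) 4) =
      bondSum n (hopMatrix t) +
        (U : ℂ) • ∑ x : Fin (n + 1), onSite (⟨x, by omega⟩ : Fin (n + 2)) siteDouble +
        ((U / 2 : ℝ) : ℂ) • ∑ x : Fin (n + 1), onSite (⟨x, by omega⟩ : Fin (n + 2)) (1 - siteTotalNumber) := by
  rw [bondMatrix, bondSum_add, bondSum_add, bondSum_smul, bondSum_smul, bondSum_kronecker,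
    bondSum_kronecker]
  simp only [onSite_one', mul_one]

/-! ### The mixture functional -/

variable {D : ℕ}

/-- The expectation functional of the boundary-propagated MPS mixture on `n + 2` sites:
`mixture A r n O = Σ_l ⟨ψ_l, O ψ_l⟩`, `ψ_l = mpsOpen (n+2) A e_l r`. -/
def mixture (A : MPSTensor 4 D) (r : Fin D → ℂ) (n : ℕ) (O : Op (Fin (n + 2)) 4) : ℂ :=
  ∑ l : Fin D, star (mpsOpen (n + 2) A (Pi.single l 1) r) ⬝ᵥ (O *ᵥ mpsOpen (n + 2) A (Pi.single l 1) r)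

variable (A : MPSTensor 4 D) (r : Fin D → ℂ) (n : ℕ)

/-- Additivity. -/
theorem mixture_add (O O' : Op (Fin (n + 2)) 4) :
    mixture A r n (O + O') = mixture A r n O + mixture A r n O' := by
  simp only [mixture, Matrix.add_mulVec, dotProduct_add, Finset.sum_add_distrib]

/-- Homogeneity. -/
theorem mixture_smul (c : ℂ) (O : Op (Fin (n + 2)) 4) :
    mixture A r n (c • O) = c * mixture A r n O := by
  simp only [mixture, Matrix.smul_mulVec, dotProduct_smul, smul_eq_mul, Finset.mul_sum]

/-- Subtraction. -/
theorem mixture_sub (O O' : Op (Fin (n + 2)) 4) :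
    mixture A r n (O - O') = mixture A r n O - mixture A r n O' := by
  simp only [mixture, Matrix.sub_mulVec, dotProduct_sub, Finset.sum_sub_distrib]

/-- Finite sums. -/
theorem mixture_sum {ι : Type*} (s : Finset ι) (O : ι → Op (Fin (n + 2)) 4) :
    mixture A r n (∑ i ∈ s, O i) = ∑ i ∈ s, mixture A r n (O i) := by
  simp only [mixture, Matrix.sum_mulVec, dotProduct_sum]
  rw [Finset.sum_comm]

/-- Positivity: `Re mixture(O) ≥ 0` for positive semidefinite `O`. -/
theorem mixture_re_nonneg {O : Op (Fin (n + 2)) 4} (hO : O.PosSemidef) : 0 ≤ (mixture A r n O).re := by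
  rw [mixture, Complex.re_sum]
  exact Finset.sum_nonneg fun l _ => (Complex.nonneg_iff.1 (hO.dotProduct_mulVec_nonneg _)).1

variable {A r}

/-- Normalisation: for a left-isometric tensor and a unit boundary vector, `mixture(1) = 1`. -/
theorem mixture_one (hA : ∑ s, (A s)ᴴ * A s = 1) (hr : star r ⬝ᵥ r = 1) :
    mixture A r n 1 = 1 := by
  simp only [mixture, Matrix.one_mulVec]
  rw [sum_star_mpsOpen_dotProduct_mpsOpen_eq hA, hr]

/-- `Re mixture(onSite x M) ≤ 1` when `1 − M ⪰ 0` (normalised mixture). -/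
theorem mixture_onSite_re_le_one (hA : ∑ s, (A s)ᴴ * A s = 1) (hr : star r ⬝ᵥ r = 1)
    (x : Fin (n + 2)) {M : Matrix (Fin 4) (Fin 4) ℂ} (hM : (1 - M).PosSemidef) :
    (mixture A r n (onSite x M)).re ≤ 1 := by
  have h := mixture_re_nonneg A r n (onSite_posSemidef x hM)
  rw [onSite_sub', onSite_one', mixture_sub, mixture_one n hA hr, Complex.sub_re, Complex.one_re] at h
  linarith

/-! ### The one-site matrices entering `g` are positive -/

/-- `n↑n↓ ⪰ 0`. -/
theorem posSemidef_siteDouble : siteDouble.PosSemidef := by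
  rw [siteDouble]
  refine posSemidef_diagonal_iff.2 fun a => ?_
  split_ifs <;> simp

/-- `1 − n↑n↓ ⪰ 0`. -/
theorem posSemidef_one_sub_siteDouble : (1 - siteDouble).PosSemidef := by
  have h : (1 - siteDouble : Matrix (Fin 4) (Fin 4) ℂ) = diagonal fun a => if a = 3 then 0 else 1 := by
    rw [siteDouble, ← diagonal_one, diagonal_sub]
    congr 1
    funext a
    split_ifs <;> simp
  rw [h]
  refine posSemidef_diagonal_iff.2 fun a => ?_
  split_ifs <;> simp

/-- `n↑ + n↓ ⪰ 0`. -/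
theorem posSemidef_siteTotalNumber : siteTotalNumber.PosSemidef := by
  rw [siteTotalNumber]
  refine posSemidef_diagonal_iff.2 fun a => ?_
  exact_mod_cast Nat.zero_le _

/-! ### Step (c): bookkeeping -/

/-- **METHOD-umps §2(c), bookkeeping.** For `U ≥ 0`, a left-isometric tensor and a unit boundary
vector, on the open chain of `n + 2` sites:
`2 Re mixture(toSpin H) + U ((n+2) − Re mixture(toSpin N̂)) ≤ 2 Re mixture(bondSum n g) + 3U`
(the two sides differ by the on-site terms of the LAST site: `2U ⟨n↑n↓⟩ + U ⟨1 − n⟩ ≤ 3U`). -/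
theorem bookkeeping_le (hA : ∑ s, (A s)ᴴ * A s = 1) (hr : star r ⬝ᵥ r = 1) (t : ℝ) {U : ℝ}
    (hU : 0 ≤ U) :
    2 * (mixture A r n (toSpin (hamiltonian (SimpleGraph.pathGraph (n + 2)) t U))).re +
        U * (((n : ℝ) + 2) - (mixture A r n (toSpin (totalNumber (Λ := Fin (n + 2))))).re) ≤
      2 * (mixture A r n (bondSum n (bondMatrix t U))).re + 3 * U := by
  -- abbreviations for the one-site expectations
  set d : Fin (n + 2) → ℝ := fun i => (mixture A r n (onSite i siteDouble)).re with hd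
  set m : Fin (n + 2) → ℝ := fun i => (mixture A r n (onSite i siteTotalNumber)).re with hm
  set h : ℝ := (mixture A r n (bondSum n (hopMatrix t))).re with hh
  have hd_le : ∀ i, d i ≤ 1 := fun i => mixture_onSite_re_le_one n hA hr i posSemidef_one_sub_siteDouble
  have hm_ge : ∀ i, 0 ≤ m i := fun i => mixture_re_nonneg A r n (onSite_posSemidef i posSemidef_siteTotalNumber)
  -- left-hand side in terms of `h, d, m`
  have hH : (mixture A r n (toSpin (hamiltonian (SimpleGraph.pathGraph (n + 2)) t U))).re =
      h + U * ∑ i, d i := by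
    rw [toSpin_hamiltonian_pathGraph_eq_bondSum, mixture_add, mixture_smul, mixture_sum, Complex.add_re,
      Complex.re_ofReal_mul, Complex.re_sum]
  have hN : (mixture A r n (toSpin (totalNumber (Λ := Fin (n + 2))))).re = ∑ i, m i := by
    rw [toSpin_totalNumber, mixture_sum, Complex.re_sum]
  -- right-hand side
  have hone : ∀ x : Fin (n + 1), (mixture A r n (onSite (⟨x, by omega⟩ : Fin (n + 2)) (1 - siteTotalNumber))).re =
      1 - m ⟨x, by omega⟩ := by
    intro x
    rw [onSite_sub', onSite_one', mixture_sub, mixture_one n hA hr, Complex.sub_re, Complex.one_re]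
  have hG : (mixture A r n (bondSum n (bondMatrix t U))).re =
      h + U * ∑ x : Fin (n + 1), d ⟨x, by omega⟩ +
        U / 2 * ∑ x : Fin (n + 1), (1 - m ⟨x, by omega⟩) := by
    rw [bondSum_bondMatrix, mixture_add, mixture_add, mixture_smul, mixture_smul, mixture_sum,
      mixture_sum, Complex.add_re, Complex.add_re, Complex.re_ofReal_mul, Complex.re_ofReal_mul,
      Complex.re_sum, Complex.re_sum]
    simp only [hone]
    rfl
  -- split the sums over all sites into the first `n + 1` sites and the last one
  have hsplit_d : ∑ i, d i = ∑ x : Fin (n + 1), d ⟨x, by omega⟩ + d (Fin.last (n + 1)) := by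
    rw [Fin.sum_univ_castSucc]
    rfl
  have hsplit_m : ∑ i, m i = ∑ x : Fin (n + 1), m ⟨x, by omega⟩ + m (Fin.last (n + 1)) := by
    rw [Fin.sum_univ_castSucc]
    rfl
  rw [hH, hN, hG, hsplit_d, hsplit_m, Finset.sum_sub_distrib, Finset.sum_const, Finset.card_univ,
    Fintype.card_fin, nsmul_eq_mul]
  push_cast
  have h1 := hd_le (Fin.last (n + 1))
  have h2 := hm_ge (Fin.last (n + 1))
  nlinarith [mul_le_mul_of_nonneg_left h1 hU, mul_nonneg hU h2]

end Summit.Ventures.CertifiedManyBodySolver.Upper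

end
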